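import Literature.AlgebraicGeometry.Motives.MixedHodgeStructureDualGr
import Literature.AlgebraicGeometry.Motives.MixedHodgeStructureBidual
import Literature.AlgebraicGeometry.Motives.MixedHodgeStructureGrWExact
import Literature.AlgebraicGeometry.Motives.HodgeStructureAbelianTypeDual
import Literature.AlgebraicGeometry.Motives.HodgeStructureDirectSum
import Literature.AlgebraicGeometry.Motives.HodgeStructureProdPolarization
import Literature.AlgebraicGeometry.Motives.HodgeTensorFactsHolds
import HarnessLib

/-!
# The dual of a graded-polarizable mixed Hodge structure is graded-polarizable

A mixed Hodge structure `H` is graded-polarizable when every `Gr^W_k H` admits a polarization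
(Carlson 1980, §2(a); the tree's `MixedHodgeStructure.IsGradedPolarizable`).  For `H` on a
finite-dimensional `V`, the graded pieces of the dual MHS `H^∨` are the duals of the graded pieces,
`Gr^W_r(H^∨) ≅ (Gr^W_{-r} H)^∨` as Hodge structures (El Zein 1983, §II.0.2; the tree's
`MixedHodgeStructure.dualGrHom`, `Motives/MixedHodgeStructureDualGr.lean`), and the dual of a polarizable
Hodge structure is polarizable (Moonen, *Families of motives and the Mumford–Tate conjecture*, §2.1:
`HS^pol_ℚ` "is closed under direct sums, tensor products and duality"; the tree's
`HodgeStructure.IsPolarizable.dual`).  Hence **`H^∨` is graded-polarizable iff `H` is** (the converse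
through the biduality isomorphism `H ≅ H^∨∨`, `MixedHodgeStructure.Hom.bidual`).

## Main results (all proved; no named facts)

* `MixedHodgeStructure.IsGradedPolarizable.of_injective` — graded-polarizability descends along an
  injective morphism of MHS (`Gr^W_k f` is then injective: `Hom.grMap_injective`; a Hodge structure
  injecting into a polarizable one is polarizable: `IsPolarizable.of_injective`, Voisin Lemma 7.26).
* `MixedHodgeStructure.isPolarizable_gr_dual` — `Gr^W_r(H^∨)` is polarizable when `Gr^W_{-r} H` is.
* **`MixedHodgeStructure.IsGradedPolarizable.dual`**, **`isGradedPolarizable_dual_iff`**.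

## References

* [Carlson1980] J. A. Carlson, Extensions of mixed Hodge structures (1980), §2(a).
* [Elzein1983] F. El Zein, Mixed Hodge structures, Trans. AMS 275 (1983), §II.0.2.
* [Moonen2017FamiliesMotives] B. Moonen, Families of motives and the Mumford–Tate conjecture, Milan J.
  Math. 85 (2017), §2.1 (p. 3).
* [VoisinHodgeI2002] C. Voisin, *Hodge Theory and Complex Algebraic Geometry I*, §7.3.1 Lemma 7.26.
-/

noncomputable section

namespace Literature.AlgebraicGeometry.Motives

namespace MixedHodgeStructure

universe u v

variable {V : Type u} [AddCommGroup V] [Module ℚ V]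
variable {V' : Type v} [AddCommGroup V'] [Module ℚ V']

/-- **Graded-polarizability descends along injective morphisms**: if `f : H₁ → H₂` is an injective
morphism of MHS and `H₂` is graded-polarizable then so is `H₁` — `Gr^W_k f : Gr^W_k H₁ → Gr^W_k H₂` is
injective (strictness; the tree's `Hom.grMap_injective`) and a Hodge structure injecting into a
polarizable one is polarizable (Voisin, Lemma 7.26; the tree's `IsPolarizable.of_injective`).
[cite: VoisinHodgeI2002, §7.3.1 Lemma 7.26] [cite: Carlson1980, §2(a)] -/
theorem IsGradedPolarizable.of_injective {H₁ : MixedHodgeStructure V} {H₂ : MixedHodgeStructure V'}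
    (h : H₂.IsGradedPolarizable) (f : MixedHodgeStructure.Hom H₁ H₂)
    (hf : Function.Injective f.toLinearMap) : H₁.IsGradedPolarizable :=
  fun k => (h k).of_injective (f.gr k) (f.grMap_injective hf k)

variable [FiniteDimensional ℚ V] (H : MixedHodgeStructure V)

/-- **`Gr^W_r(H^∨)` is polarizable when `Gr^W_{-r} H` is**: `Gr^W_r(H^∨) ≅ (Gr^W_{-r} H)^∨`
(El Zein §II.0.2; `dualGrHom`, injective) and the dual of a polarizable Hodge structure is polarizable
(Moonen §2.1; `IsPolarizable.dual`). [cite: Elzein1983, §II.0.2] [cite: Moonen2017FamiliesMotives, §2.1 (p. 3)] -/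
theorem isPolarizable_gr_dual (r : ℤ) (h : (H.gr (-r)).IsPolarizable) : (H.dual.gr r).IsPolarizable := by
  haveI : HodgeTensorFacts.{u, u} := hodgeTensorFacts_holds
  exact (h.dual.cast (neg_neg r)).of_injective (H.dualGrHom r) (H.dualGrMap_injective r)

/-- **The dual of a graded-polarizable mixed Hodge structure is graded-polarizable** (polarize
`Gr^W_r(H^∨) ≅ (Gr^W_{-r} H)^∨` by the dual polarization).
[cite: Elzein1983, §II.0.2] [cite: Moonen2017FamiliesMotives, §2.1 (p. 3)] -/
theorem IsGradedPolarizable.dual (h : H.IsGradedPolarizable) : H.dual.IsGradedPolarizable :=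
  fun r => H.isPolarizable_gr_dual r (h (-r))

/-- **`H^∨` is graded-polarizable iff `H` is** (the converse through the biduality isomorphism
`H ≅ H^∨∨`, `Hom.bidual`, and `IsGradedPolarizable.of_injective`).
[cite: Elzein1983, §II.0.2] [cite: Moonen2017FamiliesMotives, §2.1 (p. 3)] -/
theorem isGradedPolarizable_dual_iff : H.dual.IsGradedPolarizable ↔ H.IsGradedPolarizable :=
  ⟨fun h => (IsGradedPolarizable.dual H.dual h).of_injective (Hom.bidual H) (Hom.bidual_bijective H).1,
    fun h => h.dual⟩

end MixedHodgeStructure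

end Literature.AlgebraicGeometry.Motives

end
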